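import Summits.ResolutionOfSingularities.ResolutionOfSingularities.Theorems.PurelyInseparableDim4TschirnhausFrameStep
import Summits.ResolutionOfSingularities.ResolutionOfSingularities.Theorems.PurelyInseparableDim4TschirnhausCone
import Summits.ResolutionOfSingularities.ResolutionOfSingularities.Theorems.PurelyInseparableDim4ResCone
import Summits.ResolutionOfSingularities.ResolutionOfSingularities.Theorems.PurelyInseparableDim4Directrix
import HarnessLib
import HarnessLib.Audit.Tags

/-!
# Purely inseparable four-folds — the Tschirnhaus / W-frame move ALONG A WALK, part 1: the CLEAN
# re-framing of a presented state commutes with the point step (cell `res-dim4-pi`, K2(p) lane,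
# brick (ii) FILE E, part 1 of 2)

[OURS · counted 0 · cell `res-dim4-pi` · brick (ii) «Tschirnhaus / W-frame infrastructure», FILE E,
desk WORD #91 (a)(2), seat res-dim4-p-11 g3; consumer = p-5 g3's slice-C «(TS2) transfer lemma».]
Nothing here proves K2(p), `NoIsolatedTrap p p` or resolution of singularities in dimension ≥ 4 /
characteristic `p`.  AI kernel work, weaker than expert review.

FILE B2 (`…TschirnhausFrameStep`, `step_F_tsch`) says: the child of the re-coordinatised state
`⟨tsch f φ s.F, s.r, s.exc⟩` at the point `b` of chart `j ≠ f` is the RE-CLEANED re-coordinatised child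
`⟨clean (tsch f φ⁺ s′.F), s′.r, s′.exc⟩` of `s′ = step p univ j b⁺ s`, with `φ′ := chartTransform 1 univ j φ`,
`b⁺ := update b f (b f + φ′(b))`, `φ⁺ := translate b φ′ − C (φ′(b))`.  To ITERATE this along a walk one
needs the same statement for the CLEAN re-framing `T_φ s := ⟨clean (tsch f φ s.F), s.r, s.exc⟩` (the
honest presented state: a configuration's `F` is clean, WORD #1), which is this file:

* §1 the clean re-framing of one clean state: order (`ordZero_clean_tsch`), shade, boundary monomial
  `x^r ∣ F` (`forall_le_of_mem_support_clean_tsch`), initial form / residual cone for `ord₀ φ ≥ 2`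
  (`initialForm_clean_tsch_of_two_le`, `resForm_cleanTschState_of_two_le`), and IN THE BAND
  (`p ∤ ord₀ F`, e.g. `p < ord₀ F < 2p`) the cone of the clean re-framing IS the cone of the unclean one
  (`resForm_cleanTschState_eq`), whence (E4) `mem_resVertex_cleanTschState_linear_iff` /
  `finrank_resVertex_cleanTschState_linear` for LINEAR moves (FILE B3 transported); `F ≠ 0`.  Off the
  band re-cleaning can bite the initial form (`p = 3`, `F = x₁²x₂²x_f²`, `φ = x₁ + x₂`: `e_G` `3 → 1`).
* §2 **`step_cleanTsch`**: `step p univ j b (T_φ s) = T_{φ⁺} (step p univ j b⁺ s)` as an equality of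
  states (`F`, `r`, `exc`), for `s.F` clean of order `≥ p`, `j ≠ f`, `f` free (`r_f = 0`, `f ∉ exc`);
  equimultiple points, non-degeneracy and `Step0` edges correspond under `b ↦ b⁺`
  (`isEquimultiplePoint_cleanTsch_iff`, `step_F_cleanTsch_ne_zero_iff`, `step0_cleanTsch`).
* part 2 (`…TschirnhausChain`): witnessed `Step0` chains whose chart letters avoid `f` re-frame to
  witnessed `Step0` chains, with the letters carried.

bears_on: LADDER-RESOLUTION:D157-DOOR2 (res-dim4-pi · K2(p) · (ii) FILE E).  Supports
stmt-ResolutionOfSingularities-16155 (helper).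
-/

set_option linter.dupNamespace false -- mandated namespace of this single-conjunct summit

noncomputable section

namespace Summit.ResolutionOfSingularities.ResolutionOfSingularities.Theorems.PIDim4

namespace FrameChange

open MvPolynomial Finset
open Literature.AlgebraicGeometry.Resolution
open Literature.AlgebraicGeometry.Resolution.Hauser2010
open Literature.AlgebraicGeometry.Resolution.HauserPerlega2019
open Literature.AlgebraicGeometry.Resolution.CentreBlowup
open PointBlowup (translate)

variable {K : Type} [Field K]

variable {f : Fin 4} {φ : MvPolynomial (Fin 4) K}

/-! ## 1. The clean re-framing of one clean state -/

section One

variable (p : ℕ) [hp : Fact p.Prime] [CharP K p]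

/-- **Order**: for a clean `G`, `ord₀ (clean (tsch f φ G)) = ord₀ G`. [folklore] -/
theorem ordZero_clean_tsch (hφ : f ∉ φ.vars) (h0 : constantCoeff φ = 0) {G : MvPolynomial (Fin 4) K}
    (hG : deletePthPowers p G = G) : ordZero (deletePthPowers p (tsch f φ G)) = ordZero G :=
  ENat.eq_of_forall_natCast_le_iff fun n => le_ordZero_deletePthPowers_tsch_iff p hφ h0 hG n

/-- **Shade**: the clean re-framing of a clean state has the same shade. [folklore] -/
theorem shade_cleanTschState (hφ : f ∉ φ.vars) (h0 : constantCoeff φ = 0) {s : State K}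
    (hs : deletePthPowers p s.F = s.F) :
    CState.shade (⟨deletePthPowers p (tsch f φ s.F), s.r, s.exc⟩ : State K) = s.shade := by
  unfold CState.shade
  rw [ordZero_clean_tsch p hφ h0 hs]

omit hp [CharP K p] in
/-- `x^r ∣ F` monomialwise means `F = x^r · (F / x^r)`. [folklore] -/
theorem eq_monomial_mul_divMonomial {r : Fin 4 →₀ ℕ} {F : MvPolynomial (Fin 4) K}
    (hr : ∀ e ∈ F.support, r ≤ e) : F = monomial r (1 : K) * F.divMonomial r := by
  classical
  ext m
  rw [coeff_monomial_mul']
  split_ifs with h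
  · rw [one_mul, coeff_divMonomial, add_tsub_cancel_of_le h]
  · by_contra hne
    exact h (hr m (MvPolynomial.mem_support_iff.mpr hne))

omit hp [CharP K p] in
/-- The move fixes the boundary monomial: every monomial of `tsch f φ F` lies above `x^r` if every
monomial of `F` does and `r_f = 0` (`tsch f φ (x^r · G) = x^r · tsch f φ G`, FILE B1). [folklore] -/
theorem forall_le_of_mem_support_tsch {r : Fin 4 →₀ ℕ} (hrf : r f = 0) {F : MvPolynomial (Fin 4) K}
    (hr : ∀ e ∈ F.support, r ≤ e) : ∀ e ∈ (tsch f φ F).support, r ≤ e := by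
  classical
  intro e he
  rw [eq_monomial_mul_divMonomial hr, tsch_monomial_mul φ hrf, MvPolynomial.mem_support_iff,
    coeff_monomial_mul'] at he
  by_contra h
  exact he (if_neg h)

omit hp [CharP K p] in
/-- Cleaning only deletes monomials, so the bound `x^r ∣ ·` survives it. [folklore] -/
theorem forall_le_of_mem_support_deletePthPowers (q : ℕ) {r : Fin 4 →₀ ℕ} {G : MvPolynomial (Fin 4) K}
    (hr : ∀ e ∈ G.support, r ≤ e) : ∀ e ∈ (deletePthPowers q G).support, r ≤ e :=
  fun e he => hr e (MohAlong.mem_support_of_mem_support_deletePthPowers q he).1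

omit hp [CharP K p] in
/-- **Boundary monomial**: `x^r ∣ clean (tsch f φ F)` monomialwise if `x^r ∣ F` and `r_f = 0`. [folklore] -/
theorem forall_le_of_mem_support_clean_tsch (q : ℕ) {r : Fin 4 →₀ ℕ} (hrf : r f = 0)
    {F : MvPolynomial (Fin 4) K} (hr : ∀ e ∈ F.support, r ≤ e) :
    ∀ e ∈ (deletePthPowers q (tsch f φ F)).support, r ≤ e :=
  forall_le_of_mem_support_deletePthPowers q (forall_le_of_mem_support_tsch hrf hr)

omit hp [CharP K p] in
/-- The initial form of a clean polynomial is clean. [folklore] -/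
theorem deletePthPowers_initialForm_of_clean (q : ℕ) {F : MvPolynomial (Fin 4) K}
    (hF : deletePthPowers q F = F) : deletePthPowers q (initialForm F) = initialForm F := by
  classical
  ext d
  rw [coeff_deletePthPowers]
  split_ifs with hd
  · by_contra hne
    exact PointBlowup.not_isPthPowerExponent_of_clean q hF
      (ResCone.support_initialForm_subset F (MvPolynomial.mem_support_iff.mpr (Ne.symm hne))) hd
  · rfl

/-- **Initial form** (Tschirnhaus part, `ord₀ φ ≥ 2`): `in (clean (tsch f φ F)) = in F` for clean `F` —
FILE B2's `initialForm_tsch_of_two_le` plus: cleaning does not touch the (clean) lowest-degree part.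
[cite: Kollar2007, Aside 3.57] [folklore] -/
theorem initialForm_clean_tsch_of_two_le (hφ : f ∉ φ.vars) (h2 : (2 : ℕ∞) ≤ ordZero φ)
    {F : MvPolynomial (Fin 4) K} (hF : deletePthPowers p F = F) :
    initialForm (deletePthPowers p (tsch f φ F)) = initialForm F := by
  have h0 : constantCoeff φ = 0 := (mem_sq_of_two_le h2).2
  unfold initialForm
  rw [ordZero_clean_tsch p hφ h0 hF, Directrix.homogeneousComponent_deletePthPowers, ← ordZero_tsch hφ h0 F]
  change deletePthPowers p (initialForm (tsch f φ F)) = _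
  rw [initialForm_tsch_of_two_le hφ h2 F, ordZero_tsch hφ h0 F]
  exact deletePthPowers_initialForm_of_clean p hF

/-- **Residual cone** (`ord₀ φ ≥ 2`): the clean re-framing of a clean state has the same residual cone,
hence the same vertex and `e_G`. [cite: Kollar2007, Aside 3.57] [folklore] -/
theorem resForm_cleanTschState_of_two_le (hφ : f ∉ φ.vars) (h2 : (2 : ℕ∞) ≤ ordZero φ) {s : State K}
    (hs : deletePthPowers p s.F = s.F) :
    ResCone.resForm (⟨deletePthPowers p (tsch f φ s.F), s.r, s.exc⟩ : State K) = ResCone.resForm s := by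
  unfold ResCone.resForm
  dsimp only
  rw [initialForm_clean_tsch_of_two_le p hφ h2 hs]

/-- … and the same residual vertex. [folklore] -/
theorem resVertex_cleanTschState_of_two_le (hφ : f ∉ φ.vars) (h2 : (2 : ℕ∞) ≤ ordZero φ) {s : State K}
    (hs : deletePthPowers p s.F = s.F) :
    ResCone.resVertex (⟨deletePthPowers p (tsch f φ s.F), s.r, s.exc⟩ : State K) = ResCone.resVertex s := by
  unfold ResCone.resVertex
  rw [resForm_cleanTschState_of_two_le p hφ h2 hs]

omit hp [CharP K p] in
/-- A `q`-th power exponent has total degree divisible by `q`. [folklore] -/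
theorem dvd_degree_of_isPthPowerExponent (q : ℕ) {d : Fin 4 →₀ ℕ} (h : IsPthPowerExponent q d) :
    q ∣ d.degree := by
  rw [Finsupp.degree_eq_sum]
  exact Finset.dvd_sum fun i _ => (isPthPowerExponent_iff q d).mp h i

omit hp [CharP K p] in
/-- **In the band cleaning does not touch the initial form**: if `q ∤ ord₀ G` then `clean G` has the same
order (no monomial of degree `ord₀ G` is a `q`-th power). [folklore] -/
theorem ordZero_deletePthPowers_of_not_dvd (q : ℕ) {G : MvPolynomial (Fin 4) K} {o : ℕ}
    (ho : ordZero G = o) (hqo : ¬ q ∣ o) : ordZero (deletePthPowers q G) = o := by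
  classical
  obtain ⟨d, hd, hdeg⟩ : ∃ d ∈ G.support, d.degree = o := by
    have h := homogeneousComponent_ne_zero_of_ordZero_eq ho
    obtain ⟨d, hd⟩ := MvPolynomial.ne_zero_iff.mp h
    rw [coeff_homogeneousComponent] at hd
    split_ifs at hd with hdeg
    · exact ⟨d, MvPolynomial.mem_support_iff.mpr hd, hdeg⟩
    · exact absurd rfl hd
  refine le_antisymm ?_ (ho ▸ ZooCert.J001.le_ordZero_deletePthPowers q G)
  have hnot : ¬ IsPthPowerExponent q d := fun h => hqo (hdeg ▸ dvd_degree_of_isPthPowerExponent q h)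
  have hc : coeff d (deletePthPowers q G) ≠ 0 := by
    rw [coeff_deletePthPowers, if_neg hnot]
    exact MvPolynomial.mem_support_iff.mp hd
  have h := Literature.Barriers.ResolutionOfSingularities.ordZero_le_of_coeff_ne_zero _ d hc
  rw [hdeg] at h
  exact h

omit hp [CharP K p] in
/-- … and the same initial form. [folklore] -/
theorem initialForm_deletePthPowers_of_not_dvd (q : ℕ) {G : MvPolynomial (Fin 4) K} {o : ℕ}
    (ho : ordZero G = o) (hqo : ¬ q ∣ o) : initialForm (deletePthPowers q G) = initialForm G := by
  classical
  unfold initialForm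
  rw [ordZero_deletePthPowers_of_not_dvd q ho hqo, ho, ENat.toNat_coe, Directrix.homogeneousComponent_deletePthPowers]
  ext d
  rw [coeff_deletePthPowers]
  split_ifs with hd
  · rw [coeff_homogeneousComponent]
    split_ifs with hdeg
    · exact absurd (hdeg ▸ dvd_degree_of_isPthPowerExponent q hd) hqo
    · rfl
  · rfl

omit hp [CharP K p] in
/-- **In the band the clean re-framing has the cone of the unclean one**: for `p ∤ ord₀ F` (e.g.
`p < ord₀ F < 2p`, the isolated band) `resForm ⟨clean (tsch f φ s.F), r, exc⟩ = resForm ⟨tsch f φ s.F, r, exc⟩`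
— so FILE B3's / FILE C's cone and vertex statements apply to the presented (clean) state.  Off the band
this fails: `p = 3`, `F = x₁²x₂²x_f²`, `φ = x₁ + x₂` re-cleans away `2x₁³x₂³` and `e_G` drops `3 → 1`.
[folklore] -/
theorem resForm_cleanTschState_eq (hφ : f ∉ φ.vars) (h0 : constantCoeff φ = 0) {s : State K} {o : ℕ}
    (ho : ordZero s.F = o) (hpo : ¬ p ∣ o) :
    ResCone.resForm (⟨deletePthPowers p (tsch f φ s.F), s.r, s.exc⟩ : State K) =
      ResCone.resForm (⟨tsch f φ s.F, s.r, s.exc⟩ : State K) := by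
  unfold ResCone.resForm
  dsimp only
  rw [initialForm_deletePthPowers_of_not_dvd p ((ordZero_tsch hφ h0 s.F).trans ho) hpo]

omit hp [CharP K p] in
/-- … and the same residual vertex. [folklore] -/
theorem resVertex_cleanTschState_eq (hφ : f ∉ φ.vars) (h0 : constantCoeff φ = 0) {s : State K} {o : ℕ}
    (ho : ordZero s.F = o) (hpo : ¬ p ∣ o) :
    ResCone.resVertex (⟨deletePthPowers p (tsch f φ s.F), s.r, s.exc⟩ : State K) =
      ResCone.resVertex (⟨tsch f φ s.F, s.r, s.exc⟩ : State K) := by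
  unfold ResCone.resVertex
  rw [resForm_cleanTschState_eq p hφ h0 ho hpo]

omit hp [CharP K p] in
/-- **(E4) The vertex of the CLEAN LINEAR re-framing in the band**: for the linear move
`φ_c = Σ cᵢ xᵢ` of a free letter `f` (`c_f = 0`, `r_f = 0`, `x^r ∣ F`, `p ∤ ord₀ F`),
`w ∈ Vtx(T_{φ_c} s) ↔ w⁺ ∈ Vtx(s)` with `w⁺ = update w f (w f + Σ cᵢ wᵢ)` (FILE B3 + re-cleaning inert).
[folklore] -/
theorem mem_resVertex_cleanTschState_linear_iff {c : Fin 4 → K} (hc : c f = 0) {s : State K}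
    (hr0 : s.r f = 0) (hr : ∀ d ∈ s.F.support, s.r ≤ d) {o : ℕ} (ho : ordZero s.F = o) (hpo : ¬ p ∣ o)
    (w : Fin 4 → K) :
    w ∈ ResCone.resVertex (⟨deletePthPowers p (tsch f (∑ i, C (c i) * X i) s.F), s.r, s.exc⟩ : State K) ↔
      Function.update w f (w f + ∑ i, c i * w i) ∈ ResCone.resVertex s := by
  rw [resVertex_cleanTschState_eq p (not_mem_vars_linear hc)
    (constantCoeff_eq_zero_of_isHomogeneous_one (isHomogeneous_linear c)) ho hpo]
  exact mem_resVertex_tschState_linear_iff hc hr0 hr w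

omit hp [CharP K p] in
/-- **(E4) `e_G` of the CLEAN LINEAR re-framing in the band** equals `e_G`. [folklore] -/
theorem finrank_resVertex_cleanTschState_linear {c : Fin 4 → K} (hc : c f = 0) {s : State K}
    (hr0 : s.r f = 0) (hr : ∀ d ∈ s.F.support, s.r ≤ d) {o : ℕ} (ho : ordZero s.F = o) (hpo : ¬ p ∣ o) :
    Module.finrank K
        (ResCone.resVertex (⟨deletePthPowers p (tsch f (∑ i, C (c i) * X i) s.F), s.r, s.exc⟩ : State K)) =
      Module.finrank K (ResCone.resVertex s) := by
  rw [resVertex_cleanTschState_eq p (not_mem_vars_linear hc)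
    (constantCoeff_eq_zero_of_isHomogeneous_one (isHomogeneous_linear c)) ho hpo]
  exact finrank_resVertex_tschState_linear hc hr0 hr

/-- **Non-degeneracy**: for clean `G`, `clean (tsch f φ G) ≠ 0 ↔ G ≠ 0`. [folklore] -/
theorem clean_tsch_ne_zero_iff (hφ : f ∉ φ.vars) {G : MvPolynomial (Fin 4) K} (hG : deletePthPowers p G = G) :
    deletePthPowers p (tsch f φ G) ≠ 0 ↔ G ≠ 0 :=
  (deletePthPowers_tsch_eq_zero_iff p hφ hG).not

end One

/-! ## 2. The step of the clean re-framed state: `step (T_φ s) = T_{φ⁺} (step s)` -/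

section Step

variable {j : Fin 4}
variable (p : ℕ) [hp : Fact p.Prime] [CharP K p] [DecidableEq K]

/-- **THE FRAME REPRODUCES, iterable form — residual polynomial**: for a CLEAN `s.F` of order `≥ p`,
`j ≠ f`, `φ(0) = 0`, `f ∉ φ.vars`:
`(step p univ j b (T_φ s)).F = clean (tsch f φ⁺ (step p univ j b⁺ s).F)` — FILE B2's `step_F_tsch` with
the input re-cleaned (`MohAlong.deletePthPowers_translate_chartTransform_deletePthPowers`: cleaning the
input of a step does not change its cleaned output). [cite: Hauser2010, §§F–G] [folklore] -/
theorem step_F_cleanTsch {s : State K} (hq : (p : ℕ∞) ≤ ordZero s.F) (hjf : j ≠ f)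
    (h0 : constantCoeff φ = 0) (b : Fin 4 → K) :
    (step p Finset.univ j b ⟨deletePthPowers p (tsch f φ s.F), s.r, s.exc⟩).F =
      deletePthPowers p (tsch f (translate b (chartTransform 1 Finset.univ j φ) -
          C (MvPolynomial.eval b (chartTransform 1 Finset.univ j φ)))
        (step p Finset.univ j
          (Function.update b f (b f + MvPolynomial.eval b (chartTransform 1 Finset.univ j φ))) s).F) := by
  rw [← step_F_tsch p hq hjf h0 b]
  change deletePthPowers p (translate b (chartTransform p Finset.univ j (deletePthPowers p (tsch f φ s.F)))) =
    deletePthPowers p (translate b (chartTransform p Finset.univ j (tsch f φ s.F)))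
  have h := MohAlong.deletePthPowers_translate_chartTransform_deletePthPowers p 1 Finset.univ j b (tsch f φ s.F)
  rwa [pow_one] at h

omit hp [CharP K p] in
/-- New multiplicities only read `r` and `ord_{univ} F`. [folklore] -/
theorem newMult_eq_of_eq {q : ℕ} {s t : State K} (hr : s.r = t.r)
    (ho : ordAlong Finset.univ s.F = ordAlong Finset.univ t.F) (j : Fin 4) (b : Fin 4 → K) :
    newMult q Finset.univ j b s = newMult q Finset.univ j b t := by
  unfold newMult
  rw [hr, ho]

/-- **THE FRAME REPRODUCES, iterable form — multiplicities** (`s.F` clean, `f` free: `r_f = 0`). [folklore] -/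
theorem step_r_cleanTsch {s : State K} (hs : deletePthPowers p s.F = s.F) (hφ : f ∉ φ.vars)
    (h0 : constantCoeff φ = 0) (hr : s.r f = 0) (j : Fin 4) (b : Fin 4 → K) :
    (step p Finset.univ j b ⟨deletePthPowers p (tsch f φ s.F), s.r, s.exc⟩).r =
      (step p Finset.univ j
        (Function.update b f (b f + MvPolynomial.eval b (chartTransform 1 Finset.univ j φ))) s).r := by
  rw [← step_r_tsch (q := p) hφ h0 hr j b]
  change newMult p Finset.univ j b _ = newMult p Finset.univ j b _
  refine newMult_eq_of_eq (s := ⟨deletePthPowers p (tsch f φ s.F), s.r, s.exc⟩)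
    (t := ⟨tsch f φ s.F, s.r, s.exc⟩) rfl ?_ j b
  change ordAlong Finset.univ (deletePthPowers p (tsch f φ s.F)) = ordAlong Finset.univ (tsch f φ s.F)
  rw [ordAlong_univ, ordAlong_univ, ordZero_clean_tsch p hφ h0 hs, ordZero_tsch hφ h0]

omit hp [CharP K p] in
/-- **THE FRAME REPRODUCES, iterable form — boundary components** (`f ∉ exc`). [folklore] -/
theorem step_exc_cleanTsch {q : ℕ} {s : State K} (he : f ∉ s.exc) (G : MvPolynomial (Fin 4) K)
    (j : Fin 4) (b : Fin 4 → K) :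
    (step q Finset.univ j b ⟨G, s.r, s.exc⟩).exc =
      (step q Finset.univ j
        (Function.update b f (b f + MvPolynomial.eval b (chartTransform 1 Finset.univ j φ))) s).exc := by
  rw [← step_exc_tsch (q := q) (φ := φ) he j b]
  rfl

/-- **`step (T_φ s) = T_{φ⁺} (step_{b⁺} s)`** — the clean re-framing commutes with the point step, as an
equality of presented states (`s.F` clean of order `≥ p`, `j ≠ f`, `f` free, `φ` admissible).  This is
the form of FILE B2 that iterates along a walk. [cite: Hauser2010, §§F–G] [folklore] -/
theorem step_cleanTsch {s : State K} (hq : (p : ℕ∞) ≤ ordZero s.F) (hs : deletePthPowers p s.F = s.F)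
    (hjf : j ≠ f) (hφ : f ∉ φ.vars) (h0 : constantCoeff φ = 0) (hr : s.r f = 0) (he : f ∉ s.exc)
    (b : Fin 4 → K) :
    step p Finset.univ j b ⟨deletePthPowers p (tsch f φ s.F), s.r, s.exc⟩ =
      ⟨deletePthPowers p (tsch f (translate b (chartTransform 1 Finset.univ j φ) -
            C (MvPolynomial.eval b (chartTransform 1 Finset.univ j φ)))
          (step p Finset.univ j
            (Function.update b f (b f + MvPolynomial.eval b (chartTransform 1 Finset.univ j φ))) s).F),
        (step p Finset.univ j
          (Function.update b f (b f + MvPolynomial.eval b (chartTransform 1 Finset.univ j φ))) s).r,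
        (step p Finset.univ j
          (Function.update b f (b f + MvPolynomial.eval b (chartTransform 1 Finset.univ j φ))) s).exc⟩ := by
  rw [CState.mk.injEq]
  exact ⟨step_F_cleanTsch p hq hjf h0 b, step_r_cleanTsch p hs hφ h0 hr j b, step_exc_cleanTsch he _ j b⟩

/-- **Equimultiple points correspond under `b ↦ b⁺`** (clean re-framing). [cite: Hauser2010, §F] [folklore] -/
theorem isEquimultiplePoint_cleanTsch_iff {s : State K} (hq : (p : ℕ∞) ≤ ordZero s.F)
    (hjf : j ≠ f) (hφ : f ∉ φ.vars) (h0 : constantCoeff φ = 0) (b : Fin 4 → K) :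
    IsEquimultiplePoint p Finset.univ j b ⟨deletePthPowers p (tsch f φ s.F), s.r, s.exc⟩ ↔
      IsEquimultiplePoint p Finset.univ j
        (Function.update b f (b f + MvPolynomial.eval b (chartTransform 1 Finset.univ j φ))) s := by
  rw [Equimultiple.isEquimultiplePoint_iff_le_ordZero_step, Equimultiple.isEquimultiplePoint_iff_le_ordZero_step,
    step_F_cleanTsch p hq hjf h0 b]
  refine le_ordZero_deletePthPowers_tsch_iff p
    (not_mem_vars_tschShift (not_mem_vars_chartTransform 1 _ hjf hφ) b) (constantCoeff_tschShift b _) ?_ p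
  exact PointBlowup.deletePthPowers_deletePthPowers p _

/-- **Non-degeneracy corresponds** (clean re-framing). [folklore] -/
theorem step_F_cleanTsch_ne_zero_iff {s : State K} (hq : (p : ℕ∞) ≤ ordZero s.F) (hjf : j ≠ f)
    (hφ : f ∉ φ.vars) (h0 : constantCoeff φ = 0) (b : Fin 4 → K) :
    (step p Finset.univ j b ⟨deletePthPowers p (tsch f φ s.F), s.r, s.exc⟩).F ≠ 0 ↔
      (step p Finset.univ j
        (Function.update b f (b f + MvPolynomial.eval b (chartTransform 1 Finset.univ j φ))) s).F ≠ 0 := by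
  rw [step_F_cleanTsch p hq hjf h0 b]
  exact deletePthPowers_tsch_eq_zero_iff p (not_mem_vars_tschShift (not_mem_vars_chartTransform 1 _ hjf hφ) b)
    (PointBlowup.deletePthPowers_deletePthPowers p _) |>.not

end Step

end FrameChange

end Summit.ResolutionOfSingularities.ResolutionOfSingularities.Theorems.PIDim4

end
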